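import Summits.SmoothPoincare4.SmoothPoincare4.Theses.EntropyRung
import Summits.SmoothPoincare4.SmoothPoincare4.Theorems.EntropyRungSubcylindricalExistenceConformalRealisation
import Literature.Geometry.Riemannian.PerelmanEntropyCutoff
import HarnessLib

/-!
# The conformal dictionary for Perelman's `𝒲`-clause
(crux stmt-SmoothPoincare4-10871 `EntropyRung.SubcylindricalExistence`, line
`fat-conical-core-avr-logsobolev`, helper stub H-dict `helper_clauseDictionary` of lead c4's skeleton)

Data: a smooth Riemannian metric `g` (Levi-Civita) on a closed smooth `4`-manifold `M` of the
summit binder, a smooth `Φ > 0`, and a second smooth Riemannian metric `G` (Levi-Civita) with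
`G_x(v, w) = Φ(x)² g_x(v, w)` pointwise.

Claim: if the `Φ`-weighted `w²`-clause on `g` holds at level `Lv` (for every `τ > 0` and every
smooth POSITIVE `w` with `∫ (4πτ)⁻² w² Φ⁴ dV_g = 1`,
`Lv ≤ ∫ (τ (R_G w² + 4 Φ⁻² |∇w|²_g) − w² log w² − 4 w²) (4πτ)⁻² Φ⁴ dV_g`), then the crux's own
clause holds for `G` at level `Lv` (for every `τ > 0` and smooth `f` with `∫ (4πτ)⁻² e^{−f} dV_G = 1`,
`Lv ≤ ∫ (τ (R_G + |∇f|²_G) + f − 4) (4πτ)⁻² e^{−f} dV_G`).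

Proof (the transport of `stub_conformalRealisation`, steps 3–5, which only use the pointwise
identity `G = Φ² g`): `dV_G = Φ⁴ dV_g` (`riemannianMeasure_eq_withDensity_of_conformal_sq_four`,
rewritten in integrals by `integral_withDensity_eq_integral_toReal_smul`),
`|∇f|²_G = Φ⁻² |∇f|²_g` (`ConformalRealisation.gradSq_of_conformal`); given `τ, f` put
`w := e^{−f/2}` (smooth, positive): `w² = e^{−f}`, `|∇w|²_g = ¼ e^{−f} |∇f|²_g`
(`PseudoRiemannianMetric.gradSq_real_comp`), `log w² = −f`, so the normalisation transfers and the
two integrands agree pointwise (`field_simp; ring`), and the hypothesis at `w` is the claim.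
Everything is proved; no definition, no named fact.

References: G. Perelman, *The entropy formula for the Ricci flow and its geometric applications*
(2002), §3.1 [Perelman2002Entropy]; T. Aubin, *Nonlinear Analysis on Manifolds* (1982), Ch. 6,
§6.3 [Aubin1982].
-/

noncomputable section

open scoped Manifold ContDiff Topology ENNReal
open Set Filter MeasureTheory
open Literature.Geometry.Lorentzian Literature.Geometry.Riemannian

-- the registered namespace `Summit.SmoothPoincare4.SmoothPoincare4.Theorems` repeats a component
set_option linter.dupNamespace false

namespace Summit.SmoothPoincare4.SmoothPoincare4.Theorems

/-- H-dict: the conformal dictionary for Perelman's clause. If `G = Φ²g` pointwise (both with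
Levi-Civita connections) then the crux's `e^{−f}`-clause for `G` at level `Lv` follows from the
`w²`-form WEIGHTED clause on `g` (density `(4πτ)⁻²w²Φ⁴`, gradient `Φ⁻²|∇w|²_g`, potential `R_G`):
`dV_G = Φ⁴ dV_g`, `|∇f|²_G = Φ⁻²|∇f|²_g`, and `w = e^{−f/2}`.
[cite: Perelman2002Entropy, §3.1] -/
theorem helper_clauseDictionary :
    ∀ (M : Type) [TopologicalSpace M] [T2Space M] [SecondCountableTopology M]
      [ChartedSpace (EuclideanSpace ℝ (Fin 4)) M] [IsManifold (𝓡 4) ∞ M] [CompactSpace M]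
      [T3Space M] [MeasurableSpace M] [BorelSpace M]
      (g : PseudoRiemannianMetric (𝓡 4) ∞ (EuclideanSpace ℝ (Fin 4)) (TangentSpace (𝓡 4) : M → Type _))
      [g.HasLeviCivita] (hg : g.IsRiemannian) (Φ : M → ℝ)
      (G : PseudoRiemannianMetric (𝓡 4) ∞ (EuclideanSpace ℝ (Fin 4)) (TangentSpace (𝓡 4) : M → Type _))
      [G.HasLeviCivita] (hG : G.IsRiemannian) (Lv : ℝ),
      ContMDiff (𝓡 4) 𝓘(ℝ, ℝ) ∞ Φ → (∀ x, 0 < Φ x) →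
      (∀ (x : M) (v w : TangentSpace (𝓡 4) x), G.val x v w = Φ x ^ 2 * g.val x v w) →
      (∀ τ : ℝ, 0 < τ → ∀ w : M → ℝ, ContMDiff (𝓡 4) 𝓘(ℝ, ℝ) ∞ w → (∀ x, 0 < w x) →
        ∫ x, (4 * Real.pi * τ) ^ (-(4 : ℝ) / 2) * (w x) ^ 2 * (Φ x) ^ 4
            ∂(riemannianMeasure (g.toContMDiffRiemannianMetric hg)) = 1 →
          Lv ≤ ∫ x, (τ * (G.scalarCurvature x * (w x) ^ 2 + 4 * ((Φ x)⁻¹ ^ 2 * g.gradSq w x))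
              - (w x) ^ 2 * Real.log ((w x) ^ 2) - 4 * (w x) ^ 2)
              * ((4 * Real.pi * τ) ^ (-(4 : ℝ) / 2) * (Φ x) ^ 4)
            ∂(riemannianMeasure (g.toContMDiffRiemannianMetric hg))) →
      ∀ τ : ℝ, 0 < τ → ∀ f : M → ℝ, ContMDiff (𝓡 4) 𝓘(ℝ, ℝ) ∞ f →
        ∫ x, (4 * Real.pi * τ) ^ (-(4 : ℝ) / 2) * Real.exp (-f x)
            ∂(riemannianMeasure (G.toContMDiffRiemannianMetric hG)) = 1 →
          Lv ≤ ∫ x, (τ * (G.scalarCurvature x + G.gradSq f x) + f x - 4) *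
              ((4 * Real.pi * τ) ^ (-(4 : ℝ) / 2) * Real.exp (-f x))
            ∂(riemannianMeasure (G.toContMDiffRiemannianMetric hG)) := by
  intro M _ _ _ _ _ _ _ _ _ g _ hg Φ G _ hG Lv hΦ hΦpos hval hW τ hτ f hf hnorm
  -- Dictionary 1: `|∇f|²_G = Φ⁻² |∇f|²_g`
  have hgrad : ∀ (u : M → ℝ) (x : M), G.gradSq u x = (Φ x ^ 2)⁻¹ * g.gradSq u x := fun u x ↦
    ConformalRealisation.gradSq_of_conformal g G (φ := fun y ↦ Φ y ^ 2) hval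
      (pow_pos (hΦpos x) 2).ne' u
  -- Dictionary 2: `dV_G = Φ⁴ dV_g`
  set μ : Measure M := riemannianMeasure (g.toContMDiffRiemannianMetric hg) with hμ
  have hvol : riemannianMeasure (G.toContMDiffRiemannianMetric hG) =
      μ.withDensity fun x ↦ ENNReal.ofReal (Φ x ^ 4) :=
    riemannianMeasure_eq_withDensity_of_conformal_sq_four (G.toContMDiffRiemannianMetric hG)
      (g.toContMDiffRiemannianMetric hg) hΦ.continuous.measurable fun x v w ↦ by
        rw [PseudoRiemannianMetric.toContMDiffRiemannianMetric_inner,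
          PseudoRiemannianMetric.toContMDiffRiemannianMetric_inner, hval]
  have hmeas : Measurable fun x ↦ ENNReal.ofReal (Φ x ^ 4) :=
    ENNReal.measurable_ofReal.comp (hΦ.continuous.pow 4).measurable
  have hlt : ∀ᵐ x ∂μ, ENNReal.ofReal (Φ x ^ 4) < ⊤ := ae_of_all _ fun _ ↦ ENNReal.ofReal_lt_top
  have htoReal : ∀ x, (ENNReal.ofReal (Φ x ^ 4)).toReal = Φ x ^ 4 := fun x ↦
    ENNReal.toReal_ofReal (by positivity)
  -- The test function `w = e^{−f/2}`
  have hfm : ContMDiff (𝓡 4) 𝓘(ℝ, ℝ) ∞ (fun x ↦ -f x / 2) := hf.neg.div_const 2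
  have hw : ContMDiff (𝓡 4) 𝓘(ℝ, ℝ) ∞ (fun x ↦ Real.exp (-f x / 2)) :=
    Real.contDiff_exp.comp_contMDiff hfm
  have hwpos : ∀ x, 0 < Real.exp (-f x / 2) := fun x ↦ Real.exp_pos _
  have hw2 : ∀ x, Real.exp (-f x / 2) ^ 2 = Real.exp (-f x) := fun x ↦ by
    rw [sq, ← Real.exp_add]; ring_nf
  -- the normalisation transfers
  rw [hvol, integral_withDensity_eq_integral_toReal_smul hmeas hlt] at hnorm
  have hnormw : ∫ x, (4 * Real.pi * τ) ^ (-(4 : ℝ) / 2) * (Real.exp (-f x / 2)) ^ 2 * (Φ x) ^ 4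
      ∂μ = 1 := by
    rw [← hnorm]
    refine integral_congr_ae (ae_of_all _ fun x ↦ ?_)
    dsimp only
    rw [hw2 x, htoReal x, smul_eq_mul]
    ring
  -- the clause at `w`, and the pointwise match of the integrands
  have h := hW τ hτ (fun x ↦ Real.exp (-f x / 2)) hw hwpos hnormw
  rw [hvol, integral_withDensity_eq_integral_toReal_smul hmeas hlt]
  refine h.trans_eq (integral_congr_ae (ae_of_all _ fun x ↦ ?_))
  dsimp only
  have hfx : MDifferentiableAt (𝓡 4) 𝓘(ℝ, ℝ) f x := (hf x).mdifferentiableAt (by simp)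
  have hd : HasDerivAt (fun t : ℝ ↦ Real.exp (-t / 2)) (Real.exp (-f x / 2) * (-1 / 2)) (f x) := by
    have h1 : HasDerivAt (fun t : ℝ ↦ -t / 2) (-1 / 2) (f x) := by
      simpa using ((hasDerivAt_id (f x)).neg).div_const 2
    exact h1.exp
  have hgradw : g.gradSq (fun y ↦ Real.exp (-f y / 2)) x =
      (Real.exp (-f x / 2) * (-1 / 2)) ^ 2 * g.gradSq f x := by
    rw [show (fun y ↦ Real.exp (-f y / 2)) = (fun t : ℝ ↦ Real.exp (-t / 2)) ∘ f from rfl]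
    exact g.gradSq_real_comp hd hfx
  have hΦx : Φ x ≠ 0 := (hΦpos x).ne'
  rw [hgradw, mul_pow, hw2 x, Real.log_exp, htoReal x, smul_eq_mul, hgrad f x]
  field_simp
  ring

end Summit.SmoothPoincare4.SmoothPoincare4.Theorems

end
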